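import Literature.NumberTheory.Automorphic.UnboundedDenominatorsBorelFactorProofs
import Literature.LinearAlgebra.Matrix.SpecialLinearReductionSurjective

/-!
# The unbounded denominators theorem (Calegari–Dimitrov–Tang) — §4.6: Lemma 4.6.3 from Lemma 4.6.2 and Corollary 4.5.3, and Theorem 4.3.1 from {amalgam + CSP, Theorem 4.5.2}

Seventh sibling of `Literature/NumberTheory/Automorphic/UnboundedDenominators.lean`; sequel of
`UnboundedDenominatorsLeveragingProofs.lean`, `UnboundedDenominatorsSerreBergerProofs.lean` and
`UnboundedDenominatorsBorelFactorProofs.lean`. Sorry-free theorems only; NO definition, NO named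
fact (D-0026). Source: F. Calegari, V. Dimitrov, Y. Tang, *The unbounded denominators conjecture*,
J. Amer. Math. Soc. **38** (2025), 627–702 = arXiv:2109.09040v4, §§4.4–4.6 (published numbering).

## What is proved

* `forall_ker_congruence_of_agree_on_Gamma1_of_ker_congruence₂_of_cor453` — **CDT Lemma 4.6.3**
  ("Ihara's Lemma, enhanced", finite abelian coefficients) from (i) the two-sided congruence-kernel
  sentence `hker₂` (amalgam `Γ(N) ⋆ A⁻¹Γ(N)A ≅ Γ̃(N) ≤ SL₂(ℤ[1/p])` + congruence subgroup
  property; for abelian targets this is exactly **Lemma 4.6.2**, Ihara's Lemma in Ribet's form) and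
  (ii) **Corollary 4.5.3** of Theorem 4.5.2 in hypothesis form `hcor` (`η : Γ(N) → Q`; if every
  `x ↦ η(g x g⁻¹) η(x)⁻¹`, `g ∈ SL₂(ℤ)`, has congruence kernel then so has `η`). The printed proof
  ("(4.6.1) is `SL₂(ℤ/N)`-equivariant … the kernel of (4.6.4) is invariant … `(ψ^g - ψ, φ^g - φ)`
  lies in the kernel of (4.6.1) … Lemma 4.6.2 … Corollary 4.5.3") is carried out with the
  `SL₂(ℤ/N)`-action realised by conjugation by `Γ(p)` (`SL₂(ℤ) = Γ(N)·Γ(p)`,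
  `exists_mem_Gamma_mul_mem_Gamma`, from the tree's strong approximation
  `IntegerSpecialLinear.exists_specialLinearGroup_intModEq`) and the invariance of the kernel of
  (4.6.4) as: the defect `ψ/φ(A·A⁻¹)` kills the commutator `[h, x] ∈ Γ(N) ∩ Γ₁(p)` of
  `h, x ∈ Γ₀(p)`.
* `exists_congruence_modularForm_of_slash_diag_invariant_of_ker_congruence₂_of_cor453` —
  **CDT Theorem 4.3.1 from the two inputs {`hker₂`, `hcor`}**, i.e. from the classical
  amalgam/CSP sentence and CDT's cohomological Theorem 4.5.2 (via its Corollary 4.5.3): for `G`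
  normal of finite index with all conjugates of `Tᴺ`, `p ∤ N` prime, `A = diag(p, 1)`, a weight-`k`
  modular form `f` on `G` whose `f ∣ₖ A = p^{k-1} f(pτ)` is invariant under `G ∩ Γ(N p)` is
  congruence-modular.

With this file the group theory of CDT §4 (§§4.3–4.4, 4.6 and the use of §4.5) is kernel-checked
down to: the amalgam + congruence-subgroup-property sentence (classical: [Ser80 II.1.4, Tho89
Theorem 3, Ber94 p. 919; Men67, Ser70]) and Theorem 4.5.2 / Corollary 4.5.3
(`H̃¹(𝐅_ℓ)^{SL₂(ℤ̂)} = 0`, group cohomology of `SL₂(ℤ)`), both in hypothesis form; what else remains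
of §4 for Theorem 1.0.1 is the field theory of `R_N`, `M_N` (Definition 4.2.1, Lemma 4.2.3,
Theorem 4.3.2, (4.3.3)), which needs definitions.

## References

* [CalegariDimitrovTang2025] F. Calegari, V. Dimitrov, Y. Tang, The unbounded denominators
  conjecture, J. Amer. Math. Soc. 38 (2025), 627–702; arXiv:2109.09040. §4.5 (Theorem 4.5.2,
  Corollary 4.5.3), §4.6 (Lemmas 4.6.2, 4.6.3 and their proofs), §4.4 (Lemma 4.4.4).
* K. A. Ribet, Congruence relations between modular forms, Proc. ICM Warsaw 1983 (1984), 503–514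
  (Ihara's lemma in the form used by CDT).
-/

noncomputable section

namespace Literature.NumberTheory.Automorphic

open scoped MatrixGroups ModularForm
open CongruenceSubgroup Matrix.SpecialLinearGroup ModularGroup

variable {G : Subgroup SL(2, ℤ)} {N p : ℕ} {A : GL (Fin 2) ℝ}

/-! ### Bookkeeping -/

/-- Membership in `Γ(M)` as four divisibilities. [folklore] -/
private lemma mem_Gamma_iff_dvd₂ {M : ℕ} {γ : SL(2, ℤ)} :
    γ ∈ Gamma M ↔ (M : ℤ) ∣ γ 0 0 - 1 ∧ (M : ℤ) ∣ γ 0 1 ∧ (M : ℤ) ∣ γ 1 0 ∧ (M : ℤ) ∣ γ 1 1 - 1 := by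
  rw [Gamma_mem]
  have h1 : ∀ x : ℤ, (x : ZMod M) = 1 ↔ (M : ℤ) ∣ x - 1 := fun x ↦ by
    rw [← ZMod.intCast_zmod_eq_zero_iff_dvd, Int.cast_sub, Int.cast_one, sub_eq_zero]
  simp only [h1, ZMod.intCast_zmod_eq_zero_iff_dvd]

/-- The `GL₂(ℝ)` bookkeeping for `A = diag(p, 1)`: `A y = x A` as soon as `y₀₀ = x₀₀`,
`p y₀₁ = x₀₁`, `y₁₀ = p x₁₀`, `y₁₁ = x₁₁` (i.e. `y = A⁻¹ x A`). [folklore] -/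
private lemma diag_mul_mapGL_eq₂ {y x : SL(2, ℤ)} {A : GL (Fin 2) ℝ} {p : ℕ}
    (hA : (A : Matrix (Fin 2) (Fin 2) ℝ) = !![(p : ℝ), 0; 0, 1])
    (h00 : y 0 0 = x 0 0) (h01 : (p : ℤ) * y 0 1 = x 0 1) (h10 : y 1 0 = p * x 1 0)
    (h11 : y 1 1 = x 1 1) :
    A * mapGL ℝ y = mapGL ℝ x * A := by
  have r00 : ((y 0 0 : ℤ) : ℝ) = x 0 0 := by exact_mod_cast h00
  have r01 : (p : ℝ) * y 0 1 = x 0 1 := by exact_mod_cast h01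
  have r10 : ((y 1 0 : ℤ) : ℝ) = p * x 1 0 := by exact_mod_cast h10
  have r11 : ((y 1 1 : ℤ) : ℝ) = x 1 1 := by exact_mod_cast h11
  apply Units.ext
  simp only [Units.val_mul, mapGL, MonoidHom.coe_comp, Function.comp_apply, coe_GL_coe_matrix,
    map_apply_coe, RingHom.mapMatrix_apply, hA]
  ext i j
  fin_cases i <;> fin_cases j <;>
    simp only [Matrix.mul_apply, Fin.sum_univ_two, Matrix.map_apply, Matrix.of_apply,
      Matrix.cons_val', Matrix.cons_val_zero, Matrix.cons_val_one, Matrix.cons_val_fin_one,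
      Matrix.empty_val', eq_intCast, Fin.zero_eta, Fin.mk_one, Fin.isValue]
  · linear_combination (p : ℝ) * r00
  · linear_combination r01
  · linear_combination r10
  · linear_combination r11

/-- `A Γ₀(p) A⁻¹ ⊆ SL₂(ℤ)` for `A = diag(p, 1)`: for `x ∈ Γ₀(p)` there is `y` with `p ∣ y₀₁` and
`A x = y A` (`y = A x A⁻¹ = [x₀₀, p x₀₁; x₁₀/p, x₁₁]`). [folklore] -/
private lemma exists_diag_conj_of_mem_Gamma0 (hA : (A : Matrix (Fin 2) (Fin 2) ℝ) = !![(p : ℝ), 0; 0, 1])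
    {x : SL(2, ℤ)} (hx : x ∈ Gamma0 p) :
    ∃ y : SL(2, ℤ), (p : ℤ) ∣ y 0 1 ∧ A * mapGL ℝ x = mapGL ℝ y * A := by
  obtain ⟨c, hc⟩ : (p : ℤ) ∣ x 1 0 := (ZMod.intCast_zmod_eq_zero_iff_dvd _ _).mp hx
  have hdet : x 0 0 * x 1 1 - x 0 1 * x 1 0 = 1 := by
    have := Matrix.det_fin_two (x : Matrix (Fin 2) (Fin 2) ℤ)
    rw [x.det_coe] at this
    exact this.symm
  let y : SL(2, ℤ) := ⟨!![x 0 0, p * x 0 1; c, x 1 1], by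
    rw [Matrix.det_fin_two_of]; linear_combination hdet + x 0 1 * hc⟩
  exact ⟨y, ⟨x 0 1, rfl⟩, diag_mul_mapGL_eq₂ (y := x) (x := y) hA rfl rfl hc rfl⟩

/-- Conversely `A⁻¹ Γ⁰(p) A ⊆ Γ₀(p)`: for `z` with `p ∣ z₀₁` there is `x ∈ Γ₀(p)` with `A x = z A`
(`x = A⁻¹ z A = [z₀₀, z₀₁/p; p z₁₀, z₁₁]`). [folklore] -/
private lemma exists_mem_Gamma0_diag_conj_eq (hA : (A : Matrix (Fin 2) (Fin 2) ℝ) = !![(p : ℝ), 0; 0, 1])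
    {z : SL(2, ℤ)} (hpz : (p : ℤ) ∣ z 0 1) :
    ∃ x ∈ Gamma0 p, A * mapGL ℝ x = mapGL ℝ z * A := by
  obtain ⟨b, hb⟩ := hpz
  have hdet : z 0 0 * z 1 1 - z 0 1 * z 1 0 = 1 := by
    have := Matrix.det_fin_two (z : Matrix (Fin 2) (Fin 2) ℤ)
    rw [z.det_coe] at this
    exact this.symm
  let x : SL(2, ℤ) := ⟨!![z 0 0, b; p * z 1 0, z 1 1], by
    rw [Matrix.det_fin_two_of]; linear_combination hdet + z 1 0 * hb⟩
  refine ⟨x, ?_, diag_mul_mapGL_eq₂ hA rfl (by simp [x, hb]) rfl rfl⟩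
  rw [Gamma0_mem, ZMod.intCast_zmod_eq_zero_iff_dvd]
  simp only [x, Matrix.of_apply, Matrix.cons_val', Matrix.cons_val_zero, Matrix.cons_val_one,
    Matrix.cons_val_fin_one, Matrix.empty_val']
  exact dvd_mul_right _ _

/-- Integer Chinese remainder for the coprime moduli `N`, `p`. [folklore] -/
private lemma exists_dvd_sub_and_dvd_sub (hc : IsCoprime (N : ℤ) (p : ℤ)) (a b : ℤ) :
    ∃ k : ℤ, (N : ℤ) ∣ k - a ∧ (p : ℤ) ∣ k - b := by
  obtain ⟨u, v, huv⟩ := hc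
  refine ⟨a * (v * p) + b * (u * N), ⟨u * (b - a), ?_⟩, ⟨v * (a - b), ?_⟩⟩
  · linear_combination a * huv
  · linear_combination b * huv

/-- **`SL₂(ℤ) = Γ(N) · Γ(p)`** for coprime `N`, `p` (strong approximation: `SL₂(ℤ) → SL₂(ℤ/Npℤ)`
is onto, tree `IntegerSpecialLinear.exists_specialLinearGroup_intModEq`, and `ℤ/Np ≅ ℤ/N × ℤ/p`).
[folklore] -/
private lemma exists_mem_Gamma_mul_mem_Gamma (hNp : N.Coprime p) (g : SL(2, ℤ)) :
    ∃ n ∈ Gamma N, ∃ h ∈ Gamma p, g = n * h := by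
  have hc : IsCoprime (N : ℤ) (p : ℤ) := Nat.isCoprime_iff_coprime.mpr hNp
  choose k hk using fun ij : Fin 2 × Fin 2 ↦
    exists_dvd_sub_and_dvd_sub hc (g ij.1 ij.2) ((1 : Matrix (Fin 2) (Fin 2) ℤ) ij.1 ij.2)
  let M₀ : Matrix (Fin 2) (Fin 2) ℤ := Matrix.of fun i j ↦ k (i, j)
  have hMN : ∀ i j, ((M₀ i j : ℤ) : ZMod N) = ((g i j : ℤ) : ZMod N) := fun i j ↦ by
    have := (ZMod.intCast_zmod_eq_zero_iff_dvd _ N).mpr (hk (i, j)).1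
    rwa [Int.cast_sub, sub_eq_zero] at this
  have hMp : ∀ i j, ((M₀ i j : ℤ) : ZMod p) = (((1 : Matrix (Fin 2) (Fin 2) ℤ) i j : ℤ) : ZMod p) :=
    fun i j ↦ by
    have := (ZMod.intCast_zmod_eq_zero_iff_dvd _ p).mpr (hk (i, j)).2
    rwa [Int.cast_sub, sub_eq_zero] at this
  -- `det M₀ ≡ 1` modulo `N` and modulo `p`, hence modulo `N p`
  have hdet_mod : ∀ (m : ℕ) (B : Matrix (Fin 2) (Fin 2) ℤ), B.det = 1 →
      (∀ i j, ((M₀ i j : ℤ) : ZMod m) = ((B i j : ℤ) : ZMod m)) → (m : ℤ) ∣ 1 - M₀.det := by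
    intro m B hB hMB
    have hmap : M₀.map (Int.castRingHom (ZMod m)) = B.map (Int.castRingHom (ZMod m)) := by
      ext i j
      simpa only [Matrix.map_apply, eq_intCast] using hMB i j
    have h := congr_arg Matrix.det hmap
    rw [← RingHom.mapMatrix_apply, ← RingHom.mapMatrix_apply, ← RingHom.map_det,
      ← RingHom.map_det, hB, map_one, eq_intCast] at h
    rw [← ZMod.intCast_zmod_eq_zero_iff_dvd, Int.cast_sub, Int.cast_one, h, sub_self]
  have hdetN := hdet_mod N (g : Matrix (Fin 2) (Fin 2) ℤ) g.det_coe hMN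
  have hdetp := hdet_mod p 1 Matrix.det_one hMp
  have hdet : M₀.det ≡ 1 [ZMOD ((N * p : ℕ) : ℤ)] := by
    rw [Int.modEq_iff_dvd, Nat.cast_mul]
    exact hc.mul_dvd hdetN hdetp
  obtain ⟨V, hV⟩ :=
    Literature.LinearAlgebra.Matrix.IntegerSpecialLinear.exists_specialLinearGroup_intModEq
      (N * p) M₀ hdet
  have hVN : ∀ i j, ((V i j : ℤ) : ZMod N) = ((g i j : ℤ) : ZMod N) := fun i j ↦ by
    rw [← hMN i j]
    exact ((ZMod.intCast_eq_intCast_iff _ _ _).mpr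
      ((hV i j).of_mul_right p : M₀ i j ≡ V i j [ZMOD N])).symm
  have hVp : ∀ i j, ((V i j : ℤ) : ZMod p) = (((1 : Matrix (Fin 2) (Fin 2) ℤ) i j : ℤ) : ZMod p) :=
    fun i j ↦ by
    rw [← hMp i j]
    have h := hV i j
    rw [Nat.cast_mul, mul_comm] at h
    exact ((ZMod.intCast_eq_intCast_iff _ _ _).mpr (h.of_mul_right N)).symm
  refine ⟨g * V⁻¹, ?_, V, ?_, (inv_mul_cancel_right g V).symm⟩
  · rw [Gamma_mem']
    rw [map_mul, map_inv, mul_inv_eq_one]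
    ext i j
    simp only [SL_reduction_mod_hom_val]
    exact (hVN i j).symm
  · rw [Gamma_mem]
    refine ⟨?_, ?_, ?_, ?_⟩
    · simpa using hVp 0 0
    · simpa using hVp 0 1
    · simpa using hVp 1 0
    · simpa using hVp 1 1


/-- `Γ(p) ≤ Γ₀(p)`. [folklore] -/
private lemma mem_Gamma0_of_mem_Gamma {x : SL(2, ℤ)} (hx : x ∈ Gamma p) : x ∈ Gamma0 p := by
  rw [Gamma0_mem]
  exact (Gamma_mem.mp hx).2.2.1

/-- A commutator of two elements of `Γ₀(p)` lies in `Γ₁(p)` (`Γ₀(p)/Γ₁(p) ≅ (ℤ/p)ˣ` is abelian).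
[folklore] -/
private lemma commutator_mem_Gamma1 (hp : p.Prime) {h x : SL(2, ℤ)} (hh : h ∈ Gamma0 p)
    (hx : x ∈ Gamma0 p) : h * x * h⁻¹ * x⁻¹ ∈ Gamma1 p := by
  haveI : Fact p.Prime := ⟨hp⟩
  let δ : Gamma0 p →* (ZMod p)ˣ := (Gamma0Map p).toHomUnits
  have hδ : ∀ y : Gamma0 p, ((δ y : (ZMod p)ˣ) : ZMod p) = (((y : SL(2, ℤ)) 1 1 : ℤ) : ZMod p) :=
    fun y ↦ rfl
  set u : Gamma0 p := ⟨h, hh⟩ * ⟨x, hx⟩ * ⟨h, hh⟩⁻¹ * ⟨x, hx⟩⁻¹ with hu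
  have hu0 : (u : SL(2, ℤ)) ∈ Gamma0 p := u.2
  have hδu : δ u = 1 := by
    rw [hu, map_mul, map_mul, map_mul, map_inv, map_inv, mul_inv_cancel_comm, mul_inv_cancel]
  have hu11 : ((((u : SL(2, ℤ)) 1 1 : ℤ) : ZMod p)) = 1 := by
    rw [← hδ u, hδu, Units.val_one]
  have hu10 : ((((u : SL(2, ℤ)) 1 0 : ℤ) : ZMod p)) = 0 := Gamma0_mem.mp hu0
  have hu00 : ((((u : SL(2, ℤ)) 0 0 : ℤ) : ZMod p)) = 1 := by
    have hdet : ((((u : SL(2, ℤ)) 0 0 : ℤ) : ZMod p)) * (u : SL(2, ℤ)) 1 1 -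
        (u : SL(2, ℤ)) 0 1 * (u : SL(2, ℤ)) 1 0 = 1 := by
      have := Matrix.det_fin_two ((u : SL(2, ℤ)) : Matrix (Fin 2) (Fin 2) ℤ)
      rw [(u : SL(2, ℤ)).det_coe] at this
      exact_mod_cast congr_arg (fun t : ℤ ↦ (t : ZMod p)) this.symm
    rwa [hu11, hu10, mul_one, mul_zero, sub_zero] at hdet
  exact (Gamma1_mem p _).mpr ⟨hu00, hu11, hu10⟩

/-- **CDT Lemma 4.6.3 ("Ihara's Lemma, enhanced") from Lemma 4.6.2 and Corollary 4.5.3, hypothesis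
form** [cite: CalegariDimitrovTang2025, Lemma 4.6.3]. Let `p` be a prime not dividing `N`,
`A = diag(p, 1)`. ASSUME (i) the two-sided congruence-kernel sentence `hker₂` — for a finite group
`Δ` and `g₁, g₂ : Γ(N) → Δ` with `g₁ x = g₂ (A x A⁻¹)` on `Γ(N) ∩ Γ₀(p)`, BOTH kernels are
congruence (the amalgam `Γ(N) ⋆ A⁻¹Γ(N)A ≅ Γ̃(N) ≤ SL₂(ℤ[1/p])` and the congruence subgroup
property; for abelian `Δ` this is Lemma 4.6.2 = Ihara's Lemma as proved by Ribet) and (ii) CDT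
Corollary 4.5.3 of Theorem 4.5.2 in hypothesis form `hcor` (finite abelian coefficients `Q`, cf. the
`ℚ/ℤ`-remark after Theorem 4.5.2): if `θ : Γ(N) → Q` is a homomorphism such that for every
`g ∈ SL₂(ℤ)` the class `x ↦ θ(g x g⁻¹) θ(x)⁻¹` has congruence kernel, then `θ` has congruence kernel.
THEN Lemma 4.6.3: homomorphisms `ψ, φ : Γ(N) → Q` with `ψ x = φ (A x A⁻¹)` for all
`x ∈ Γ(N) ∩ Γ₁(p)` both have congruence kernels. Proof as printed: for `h ∈ Γ₀(p)` and
`h' = A h A⁻¹`, the twisted classes `ψ_h = ψ(h·h⁻¹)/ψ`, `φ_{h'}` agree on `Γ(N) ∩ Γ₀(p)` (the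
defect `c = ψ/φ(A·A⁻¹)` kills `Γ(N) ∩ Γ₁(p) ∋ [h, x]`, "the kernel of (4.6.4) is invariant"), so
are congruence by (i); every `g ∈ SL₂(ℤ)` is `n h` with `n ∈ Γ(N)` (acting trivially, `Q` abelian)
and `h ∈ Γ(p)` (`SL₂(ℤ) = Γ(N)Γ(p)`), so (ii) applies to `ψ`, and symmetrically to `φ`. -/
theorem forall_ker_congruence_of_agree_on_Gamma1_of_ker_congruence₂_of_cor453
    (hp : p.Prime) (hNp : N.Coprime p) (hA : (A : Matrix (Fin 2) (Fin 2) ℝ) = !![(p : ℝ), 0; 0, 1])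
    (hker₂ : ∀ (Δ : Type) [Group Δ] [Finite Δ] (g₁ g₂ : Gamma N →* Δ),
      (∀ (x : SL(2, ℤ)) (hx : x ∈ Gamma N), x ∈ Gamma0 p → ∀ (y : SL(2, ℤ)) (hy : y ∈ Gamma N),
        A * mapGL ℝ x = mapGL ℝ y * A → g₁ ⟨x, hx⟩ = g₂ ⟨y, hy⟩) →
      (∃ M : ℕ, M ≠ 0 ∧ ∀ (x : SL(2, ℤ)) (hx : x ∈ Gamma N), x ∈ Gamma M → g₁ ⟨x, hx⟩ = 1) ∧
      (∃ M : ℕ, M ≠ 0 ∧ ∀ (x : SL(2, ℤ)) (hx : x ∈ Gamma N), x ∈ Gamma M → g₂ ⟨x, hx⟩ = 1))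
    (hcor : ∀ (Q : Type) [CommGroup Q] [Finite Q] (θ : Gamma N →* Q),
      (∀ g : SL(2, ℤ), ∃ M : ℕ, M ≠ 0 ∧ ∀ (x : SL(2, ℤ)) (hx : x ∈ Gamma N)
        (hgx : g * x * g⁻¹ ∈ Gamma N), x ∈ Gamma M → θ ⟨g * x * g⁻¹, hgx⟩ = θ ⟨x, hx⟩) →
      ∃ M : ℕ, M ≠ 0 ∧ ∀ (x : SL(2, ℤ)) (hx : x ∈ Gamma N), x ∈ Gamma M → θ ⟨x, hx⟩ = 1) :
    ∀ (Q : Type) [CommGroup Q] [Finite Q] (ψ φ : Gamma N →* Q),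
      (∀ (x : SL(2, ℤ)) (hx : x ∈ Gamma N), x ∈ Gamma1 p → ∀ (y : SL(2, ℤ)) (hy : y ∈ Gamma N),
        A * mapGL ℝ x = mapGL ℝ y * A → ψ ⟨x, hx⟩ = φ ⟨y, hy⟩) →
      (∃ M : ℕ, M ≠ 0 ∧ ∀ (x : SL(2, ℤ)) (hx : x ∈ Gamma N), x ∈ Gamma M → ψ ⟨x, hx⟩ = 1) ∧
      (∃ M : ℕ, M ≠ 0 ∧ ∀ (x : SL(2, ℤ)) (hx : x ∈ Gamma N), x ∈ Gamma M → φ ⟨x, hx⟩ = 1) := by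
  intro Q _ _ ψ φ hag
  haveI : (Gamma N).Normal := Gamma_normal N
  have hinj : ∀ y y' : SL(2, ℤ), mapGL ℝ y = mapGL ℝ y' → y = y' := fun y y' h ↦
    mapGL_injective h
  -- the twisted classes `χ_h = χ(h · h⁻¹) / χ`
  let tw : SL(2, ℤ) → (Gamma N →* Q) → (Gamma N →* Q) :=
    fun h χ ↦ χ.comp (MulAut.conjNormal h).toMonoidHom / χ
  have htw : ∀ (h : SL(2, ℤ)) (χ : Gamma N →* Q) (x : Gamma N),
      tw h χ x = χ (MulAut.conjNormal h x) / χ x := fun h χ x ↦ rfl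
  have hconj : ∀ (h : SL(2, ℤ)) (x : Gamma N),
      ((MulAut.conjNormal h x : Gamma N) : SL(2, ℤ)) = h * x * h⁻¹ := fun h x ↦
    MulAut.conjNormal_apply h x
  -- KEY: for `h ∈ Γ₀(p)` and `A h = h' A`, the pair `(ψ_h, φ_{h'})` agrees on `Γ(N) ∩ Γ₀(p)`
  have key : ∀ (h : SL(2, ℤ)), h ∈ Gamma0 p → ∀ h' : SL(2, ℤ), A * mapGL ℝ h = mapGL ℝ h' * A →
      (∃ M : ℕ, M ≠ 0 ∧ ∀ (x : SL(2, ℤ)) (hx : x ∈ Gamma N), x ∈ Gamma M → tw h ψ ⟨x, hx⟩ = 1) ∧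
      (∃ M : ℕ, M ≠ 0 ∧ ∀ (x : SL(2, ℤ)) (hx : x ∈ Gamma N), x ∈ Gamma M → tw h' φ ⟨x, hx⟩ = 1) := by
    intro h hh h' hAh
    refine hker₂ Q (tw h ψ) (tw h' φ) fun x hx hx0 y hy hxy ↦ ?_
    -- `U = [h, x] ∈ Γ(N) ∩ Γ₁(p)`, `V = [h', y] = A U A⁻¹`
    let X : Gamma N := ⟨x, hx⟩
    let Y : Gamma N := ⟨y, hy⟩
    let U : Gamma N := MulAut.conjNormal h X * X⁻¹
    let V : Gamma N := MulAut.conjNormal h' Y * Y⁻¹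
    have hU : (U : SL(2, ℤ)) = h * x * h⁻¹ * x⁻¹ := by
      change ((MulAut.conjNormal h X : Gamma N) : SL(2, ℤ)) * x⁻¹ = _
      rw [hconj]
    have hV : (V : SL(2, ℤ)) = h' * y * h'⁻¹ * y⁻¹ := by
      change ((MulAut.conjNormal h' Y : Gamma N) : SL(2, ℤ)) * y⁻¹ = _
      rw [hconj]
    have hU1 : (U : SL(2, ℤ)) ∈ Gamma1 p := by
      rw [hU]
      exact commutator_mem_Gamma1 hp hh hx0
    have hUV : A * mapGL ℝ (U : SL(2, ℤ)) = mapGL ℝ (V : SL(2, ℤ)) * A := by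
      have eh : mapGL ℝ h' = A * mapGL ℝ h * A⁻¹ := eq_mul_inv_iff_mul_eq.mpr hAh.symm
      have ey : mapGL ℝ y = A * mapGL ℝ x * A⁻¹ := eq_mul_inv_iff_mul_eq.mpr hxy.symm
      rw [hU, hV]
      simp only [map_mul, map_inv, eh, ey]
      group
    have hagUV := hag U U.2 hU1 V V.2 hUV
    have hψU : ψ U = tw h ψ ⟨x, hx⟩ := by
      show ψ (MulAut.conjNormal h X * X⁻¹) = _
      rw [htw, map_mul, map_inv, div_eq_mul_inv]
    have hφV : φ V = tw h' φ ⟨y, hy⟩ := by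
      show φ (MulAut.conjNormal h' Y * Y⁻¹) = _
      rw [htw, map_mul, map_inv, div_eq_mul_inv]
    rw [← hψU, ← hφV]
    simpa using hagUV
  -- the inner action of `Γ(N)` on `Hom(Γ(N), Q)` is trivial (`Q` abelian)
  have hinner : ∀ (χ : Gamma N →* Q) (n : SL(2, ℤ)) (hn : n ∈ Gamma N) (z : Gamma N),
      χ (MulAut.conjNormal n z) = χ z := by
    intro χ n hn z
    have : MulAut.conjNormal n z = ⟨n, hn⟩ * z * ⟨n, hn⟩⁻¹ := Subtype.ext (by rw [hconj]; rfl)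
    rw [this, map_mul, map_mul, map_inv, mul_inv_cancel_comm]
  -- conjugation by `g = n h`: `χ(g x g⁻¹) = χ(h x h⁻¹)`
  have hsplit : ∀ (χ : Gamma N →* Q) (n h x : SL(2, ℤ)) (hn : n ∈ Gamma N) (hx : x ∈ Gamma N)
      (hgx : n * h * x * (n * h)⁻¹ ∈ Gamma N),
      χ ⟨n * h * x * (n * h)⁻¹, hgx⟩ = χ (MulAut.conjNormal h ⟨x, hx⟩) := by
    intro χ n h x hn hx hgx
    have : (⟨n * h * x * (n * h)⁻¹, hgx⟩ : Gamma N) =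
        MulAut.conjNormal n (MulAut.conjNormal h ⟨x, hx⟩) := by
      apply Subtype.ext
      rw [hconj, hconj]
      group
    rw [this, hinner χ n hn]
  -- Corollary 4.5.3 applies to `ψ` …
  have hψ : ∀ g : SL(2, ℤ), ∃ M : ℕ, M ≠ 0 ∧ ∀ (x : SL(2, ℤ)) (hx : x ∈ Gamma N)
      (hgx : g * x * g⁻¹ ∈ Gamma N), x ∈ Gamma M → ψ ⟨g * x * g⁻¹, hgx⟩ = ψ ⟨x, hx⟩ := by
    intro g
    obtain ⟨n, hn, h, hhp, rfl⟩ := exists_mem_Gamma_mul_mem_Gamma hNp g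
    obtain ⟨h', -, hAh⟩ := exists_diag_conj_of_mem_Gamma0 hA (mem_Gamma0_of_mem_Gamma hhp)
    obtain ⟨⟨M, hM, hMψ⟩, -⟩ := key h (mem_Gamma0_of_mem_Gamma hhp) h' hAh
    refine ⟨M, hM, fun x hx hgx hxM ↦ ?_⟩
    have h1 := hMψ x hx hxM
    rw [htw, div_eq_one] at h1
    rw [hsplit ψ n h x hn hx hgx, h1]
  -- … and to `φ` (with `h' ∈ Γ(p)` given, `h = A⁻¹ h' A ∈ Γ₀(p)`)
  have hφ : ∀ g : SL(2, ℤ), ∃ M : ℕ, M ≠ 0 ∧ ∀ (x : SL(2, ℤ)) (hx : x ∈ Gamma N)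
      (hgx : g * x * g⁻¹ ∈ Gamma N), x ∈ Gamma M → φ ⟨g * x * g⁻¹, hgx⟩ = φ ⟨x, hx⟩ := by
    intro g
    obtain ⟨n, hn, h', hh'p, rfl⟩ := exists_mem_Gamma_mul_mem_Gamma hNp g
    have hp01 : (p : ℤ) ∣ h' 0 1 := (mem_Gamma_iff_dvd₂.mp hh'p).2.1
    obtain ⟨h, hh0, hAh⟩ := exists_mem_Gamma0_diag_conj_eq hA hp01
    obtain ⟨-, ⟨M, hM, hMφ⟩⟩ := key h hh0 h' hAh
    refine ⟨M, hM, fun x hx hgx hxM ↦ ?_⟩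
    have h1 := hMφ x hx hxM
    rw [htw, div_eq_one] at h1
    rw [hsplit φ n h' x hn hx hgx, h1]
  exact ⟨hcor Q ψ hψ, hcor Q φ hφ⟩


/-- **CDT Theorem 4.3.1 from the two inputs of §4: the amalgam/CSP sentence and Corollary 4.5.3**
[cite: CalegariDimitrovTang2025, Theorem 4.3.1, Lemma 4.4.1, Lemma 4.6.3 and Corollary 4.5.3]. Let
`G ≤ SL(2, ℤ)` be normal of finite index containing every conjugate of `Tᴺ`, `p` a prime not dividing
`N ≠ 0`, `A = diag(p, 1)`. Assume the two-sided congruence-kernel sentence `hker₂` (amalgam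
`SL₂(ℤ[1/p]) ⊇ Γ̃(N) = Γ(N) ⋆ A⁻¹Γ(N)A` + congruence subgroup property) and CDT Corollary 4.5.3
in hypothesis form `hcor`. If `f` is a weight-`k` modular form on `G` such that
`f ∣ₖ A = p^{k-1} f(pτ)` is invariant under `G ∩ Γ(N p)`, then `f` is a modular form on a congruence
subgroup. (Lemma 4.4.1, the Borel factor of Lemma 4.4.4, Lemma 4.6.3, display (4.4.9), Wohlfahrt's
theorem and the passage `f(pτ) ↦ f` are all proved in the tree.) -/
theorem exists_congruence_modularForm_of_slash_diag_invariant_of_ker_congruence₂_of_cor453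
    [G.Normal] [G.FiniteIndex] {k : ℤ} (hT : ∀ g : SL(2, ℤ), g * T ^ N * g⁻¹ ∈ G) (hN : N ≠ 0)
    (hp : p.Prime) (hNp : N.Coprime p) (hA : (A : Matrix (Fin 2) (Fin 2) ℝ) = !![(p : ℝ), 0; 0, 1])
    (hker₂ : ∀ (Δ : Type) [Group Δ] [Finite Δ] (g₁ g₂ : Gamma N →* Δ),
      (∀ (x : SL(2, ℤ)) (hx : x ∈ Gamma N), x ∈ Gamma0 p → ∀ (y : SL(2, ℤ)) (hy : y ∈ Gamma N),
        A * mapGL ℝ x = mapGL ℝ y * A → g₁ ⟨x, hx⟩ = g₂ ⟨y, hy⟩) →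
      (∃ M : ℕ, M ≠ 0 ∧ ∀ (x : SL(2, ℤ)) (hx : x ∈ Gamma N), x ∈ Gamma M → g₁ ⟨x, hx⟩ = 1) ∧
      (∃ M : ℕ, M ≠ 0 ∧ ∀ (x : SL(2, ℤ)) (hx : x ∈ Gamma N), x ∈ Gamma M → g₂ ⟨x, hx⟩ = 1))
    (hcor : ∀ (Q : Type) [CommGroup Q] [Finite Q] (θ : Gamma N →* Q),
      (∀ g : SL(2, ℤ), ∃ M : ℕ, M ≠ 0 ∧ ∀ (x : SL(2, ℤ)) (hx : x ∈ Gamma N)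
        (hgx : g * x * g⁻¹ ∈ Gamma N), x ∈ Gamma M → θ ⟨g * x * g⁻¹, hgx⟩ = θ ⟨x, hx⟩) →
      ∃ M : ℕ, M ≠ 0 ∧ ∀ (x : SL(2, ℤ)) (hx : x ∈ Gamma N), x ∈ Gamma M → θ ⟨x, hx⟩ = 1)
    (f : ModularForm (G : Subgroup (GL (Fin 2) ℝ)) k)
    (hinv : ∀ γ ∈ G ⊓ Gamma (N * p), (⇑f ∣[k] A) ∣[k] (mapGL ℝ γ) = ⇑f ∣[k] A) :
    ∃ (Γ' : Subgroup SL(2, ℤ)) (g : ModularForm (Γ' : Subgroup (GL (Fin 2) ℝ)) k),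
      IsCongruenceSubgroup Γ' ∧ (g : UpperHalfPlane → ℂ) = f :=
  exists_congruence_modularForm_of_slash_diag_invariant_of_ker_congruence_of_ihara hT hN hp hNp hA
    (fun Δ _ _ g₁ g₂ h ↦ (hker₂ Δ g₁ g₂ h).1)
    (forall_ker_congruence_of_agree_on_Gamma1_of_ker_congruence₂_of_cor453 hp hNp hA hker₂ hcor)
    f hinv

end Literature.NumberTheory.Automorphic

end
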